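import Mathlib
import HarnessLib
import Summits.HubbardSuperconductivity.HubbardSuperconductivity.Theorems.KLProgrammeKLRegimeEngineGeneralStepPrivStepOfPosPureC2
import Summits.HubbardSuperconductivity.HubbardSuperconductivity.Theorems.KLProgrammeKLRegimeFlowReadTransportOneCallL2

/-!
# K3 gen-8-FLOW (stmt 20437, stub (C)): «(C2)-L-SHARP» ∘ «(B)-MAIN-PURE» — the general (P)-step with (B) and (C2) discharged, (C2) on the U-AWARE (L2) table —
# `twoLegReadPriv_flow_succ_of_pos_pure_c2_l2` (cell gate-hubbard-kl, seat p2 g23)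

= p2 g22's `twoLegReadPriv_flow_succ_of_pos_pure` (p658457) ∘ `transport_jets_flow_fit_of_spaceMoments_l2` (…FlowReadTransportOneCallL2): as
`twoLegReadPriv_flow_succ_of_pos_pure_c2_sharp` but the primed (C2) table `eT′` only has to dominate the L2 table (degree ≤ 2 in `R.Gfr` — located «(C2)-L-DEGREE»
cured), at the price of the hypothesis `2(Gfr₃+Gfr₄)U² ≤ 1` (automatic at stub binders: `Gfr_j·U ≤ 2⁻¹²⁷`, see …AllDoorsL2).
Composition only; no definitions; nothing asserts any stub of 20437, K3, the margin or superconductivity.  References: BGM 2006 §2.4 Lemma 2.1 (2.36)–(2.42)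
[cite: BenfattoGiulianiMastropietro2006]; FST 1996 §1 [cite: FeldmanSalmhoferTrubowitz1996].
-/

noncomputable section

namespace Summit.HubbardSuperconductivity.HubbardSuperconductivity.Theorems.EngineV8

set_option linter.dupNamespace false -- summit = problem name (single-conjunct summit), D-0017
set_option exponentiation.threshold 1024 -- `2^200`/`2^282` literals in the budget expressions

open Complex Real Finset Filter Literature.MathematicalPhysics.QuantumLattice Literature.Probability.LatticeModels GrassmannAlgebra
open Literature.MathematicalPhysics.QuantumLattice.BandSectorCounting Literature.MathematicalPhysics.QuantumLattice.FermiRG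
open Literature.Analysis.Fourier Literature.Analysis.Calculus
open Summit.HubbardSuperconductivity.HubbardSuperconductivity.Theorems.KLRegimeSplit
open Summit.HubbardSuperconductivity.HubbardSuperconductivity.Theorems.DispersionFlow
open Summit.HubbardSuperconductivity.HubbardSuperconductivity.Theorems.KLProgrammeLegKernels
open Summit.HubbardSuperconductivity.HubbardSuperconductivity.Theorems.PerturbedFermiCurve
open scoped Nat

variable {L M : ℕ} [NeZero L] [NeZero M]

/-- **L2 TWIN** of `twoLegReadPriv_flow_succ_of_pos_pure_c2_sharp` («(C2)-L-SHARP»): the (C2) rows are read on the U-AWARE table of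
`transport_jets_flow_fit_of_spaceMoments_l2` (every `(1 + 2(Gfr₃+Gfr₄))` replaced by `2`, hypothesis `2(Gfr₃+Gfr₄)U² ≤ 1`), still at the sharp cutoff table; i.e. the (C2) frame constant of row `j = 5` is read at p2 g18's cutoff
table `klChi2CauchyTab2 4 = 65550` (`salmhoferCutoff_flat_cauchy_table2 4`) instead of the (B) door's `X₄ = 8·576·342⁴ ≈ 6.3·10¹³` — the order-5 frame entry of
`eT′ 4` (`(3.48·10¹⁰/16)·Gfr₀·mT 5`, `mT 5 ≥ 2⁵π⁸2³⁴/63·W(X)`, `W(X) = curveExtC X G.S 1 + …`) is `10⁹`× smaller; the (B) bracket keeps its own `W`.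
[cite: BenfattoGiulianiMastropietro2006, §2.4 Lemma 2.1 (2.36)–(2.42)] -/
theorem twoLegReadPriv_flow_succ_of_pos_pure_c2_l2 {R : RenConsts} (hR : ∀ j, 0 ≤ R.Gfr j) {c : ℝ} (hc : 0 < c) (hcle : c ≤ klCurveC3 R)
    {U : ℝ} (hU : 0 < U) (hU1 : U ≤ 1) (hUle : U ≤ klCurveU0 R)
    (hG34U : 2 * (R.Gfr 3 + R.Gfr 4) * U ^ 2 ≤ 1) {β : ℝ} (hβmin : klBetaMin ≤ β) (hβc : β ≤ Real.exp (c / U ^ 2))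
    {μ : ℝ} (hμ : μ ∈ klWindowC) (m : ℕ) (hm1 : m + 1 ≤ nScales β)
    {G : GeoConsts} {Q : EngConsts} (hGS : ∀ k, 0 ≤ G.S k) (hQS : ∀ k, 0 ≤ Q.S' k)
    {Nf₁ N : ℕ} (hOK₁ : FrameOK R U Nf₁ μ (klFlowFrameU L M β U μ m)) (hN₁ : Nf₁ ≤ m) (hOK₂ : FrameOK R U N μ (klFlowFrameU L M β U μ (m + 1))) (hNn : N ≤ m)
    (hZ₂ : IsUnit (effPartitionFn ℂ (normalCovariance L M (uvSymbolCT L M β μ (klFlowFrameU L M β U μ (m + 1)) (klScale klE0 m))) (hubbardInteraction L M β U + counterQuadratic L M β (klFlowFrameU L M β U μ (m + 1)))))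
    (hZ : ∀ t ∈ Set.Icc (0 : ℝ) 1, effPartitionFn ℂ
      (normalCovariance L M (uvSymbolCT L M β μ (klFlowFrameU L M β U μ m) (klScale klE0 m)) + ((t : ℂ)) • (normalCovariance L M (fun ks => uvSymbolCT L M β μ (klFlowFrameU L M β U μ (m + 1)) (klScale klE0 m) ks / (1 + uvSymbolCT L M β μ (klFlowFrameU L M β U μ (m + 1)) (klScale klE0 m) ks * (((fsub (klFlowFrameU L M β U μ (m + 1)) (klFlowFrameU L M β U μ m)).eval (latticeMomentum L ks.1.2) / (β * (L : ℝ) ^ 2) : ℝ) : ℂ))) - normalCovariance L M (uvSymbolCT L M β μ (klFlowFrameU L M β U μ m) (klScale klE0 m)))) (hubbardInteraction L M β U + counterQuadratic L M β (klFlowFrameU L M β U μ m)) ≠ 0)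
    -- the flow history and the closed envelopes (verbatim from the door)
    {n : ℕ} (hP : ∀ m' ≤ n, FlowPieceJetsAt L M β U μ R m') (hTJ : ∀ m' ≤ n, TwoLegReadJetsF L M G Q β U μ m') (hmn : m ≤ n)
    (hR0 : 0 < R.Gfr 0) {W Ξ Θ : ℝ} (hW : W = curveExtC (8 * 576 * (342 : ℝ) ^ 4) G.S 1 + curveExtC (8 * 576 * (342 : ℝ) ^ 4) Q.S' 1 * |U|)
    (hΞ : Ξ = (2 ^ 10 * (1 + Real.pi ^ 8 * (W * U ^ 2) / 2 ^ 11) + ∑ j ∈ range 5, R.Gfr j))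
    (hΘ : Θ = (1 + ((∑ j ∈ range 5, R.Gfr j) + Real.pi ^ 8 * W / 2 ^ 11) * |U| / R.Gfr 0))
    (hdoor : R.Gfr 0 * |U| + ((∑ j ∈ range 5, R.Gfr j) + Real.pi ^ 8 * W / 2 ^ 11) * U ^ 2 ≤ 1 / 128) {P : SplitConsts} (hL : klEngL₄ P R β U ≤ L)
    {s : ℕ} (hs : 30 ≤ s)
    -- E1: β-free graded constant families (four-leg: PURE weight, `U²` law at orders ≥ 1)
    {cN cS cE : ℕ → ℝ} {cSs cEs : ℝ} (hcN : ∀ l, 0 ≤ cN l) (hcS : ∀ l, 0 ≤ cS l) (hcE : ∀ l, 0 ≤ cE l) (hcSs : 0 ≤ cSs) (hcEs : 0 ≤ cEs)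
    (hNp0 : ∀ t ∈ Set.Icc (0 : ℝ) 1, ∀ (σ : Fin 2) (A : HubbardFieldIdx L M) (x₀ : SpaceTimeIdx L M), imagTimeWeight β M ^ 3 *
      ∑ x ∈ (univ : Finset (Fin 4 → SpaceTimeIdx L M)).filter (fun x => x 0 = x₀),
        (((((x 1).2 - (x 0).2) 0).valMinAbs.natAbs : ℝ) + ((((x 1).2 - (x 0).2) 1).valMinAbs.natAbs : ℝ)) ^ 0 *
          ‖sectorisedKernel L M β (trivialMultiplier L M)
            (effAction ℂ (normalCovariance L M (uvSymbolCT L M β μ (klFlowFrameU L M β U μ m) (klScale klE0 m)) + ((t : ℂ)) • (normalCovariance L M (fun ks => uvSymbolCT L M β μ (klFlowFrameU L M β U μ (m + 1)) (klScale klE0 m) ks / (1 + uvSymbolCT L M β μ (klFlowFrameU L M β U μ (m + 1)) (klScale klE0 m) ks * (((fsub (klFlowFrameU L M β U μ (m + 1)) (klFlowFrameU L M β U μ m)).eval (latticeMomentum L ks.1.2) / (β * (L : ℝ) ^ 2) : ℝ) : ℂ))) - normalCovariance L M (uvSymbolCT L M β μ (klFlowFrameU L M β U μ m) (klScale klE0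 m)))) (hubbardInteraction L M β U + counterQuadratic L M β (klFlowFrameU L M β U μ m))) 4
            (![((0, σ), 0), ((0, σ), 1), ((0, A.1.2), 1 - A.2), ((0, A.1.2), A.2)] : Fin 4 → SectorLeg 1) x‖ ≤ cN 0 * U)
    (hNp : ∀ l, 1 ≤ l → l ≤ 4 → ∀ t ∈ Set.Icc (0 : ℝ) 1, ∀ (σ : Fin 2) (A : HubbardFieldIdx L M) (x₀ : SpaceTimeIdx L M), imagTimeWeight β M ^ 3 *
      ∑ x ∈ (univ : Finset (Fin 4 → SpaceTimeIdx L M)).filter (fun x => x 0 = x₀),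
        (((((x 1).2 - (x 0).2) 0).valMinAbs.natAbs : ℝ) + ((((x 1).2 - (x 0).2) 1).valMinAbs.natAbs : ℝ)) ^ l *
          ‖sectorisedKernel L M β (trivialMultiplier L M)
            (effAction ℂ (normalCovariance L M (uvSymbolCT L M β μ (klFlowFrameU L M β U μ m) (klScale klE0 m)) + ((t : ℂ)) • (normalCovariance L M (fun ks => uvSymbolCT L M β μ (klFlowFrameU L M β U μ (m + 1)) (klScale klE0 m) ks / (1 + uvSymbolCT L M β μ (klFlowFrameU L M β U μ (m + 1)) (klScale klE0 m) ks * (((fsub (klFlowFrameU L M β U μ (m + 1)) (klFlowFrameU L M β U μ m)).eval (latticeMomentum L ks.1.2) / (β * (L : ℝ) ^ 2) : ℝ) : ℂ))) - normalCovariance L M (uvSymbolCT L M β μ (klFlowFrameU L M β U μ m) (klScale klE0 m)))) (hubbardInteraction L M β U + counterQuadratic L M β (klFlowFrameU L M β U μ m))) 4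
            (![((0, σ), 0), ((0, σ), 1), ((0, A.1.2), 1 - A.2), ((0, A.1.2), A.2)] : Fin 4 → SectorLeg 1) x‖ ≤ cN l * U ^ 2 * ((4 : ℝ) ^ m) ^ l)
    (hSp : ∀ l ≤ 4, ∀ t ∈ Set.Icc (0 : ℝ) 1, ∀ (σ : Fin 2) (x₀ : SpaceTimeIdx L M),
      (imagTimeWeight β M * ∑ x ∈ (univ : Finset (Fin 2 → SpaceTimeIdx L M)).filter (fun x => x 0 = x₀),
        (1 + ((((x 1).2 - (x 0).2) 0).valMinAbs.natAbs : ℝ) + ((((x 1).2 - (x 0).2) 1).valMinAbs.natAbs : ℝ)) ^ l *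
          ‖sectorisedKernel L M β (trivialMultiplier L M)
            (effAction ℂ (normalCovariance L M (uvSymbolCT L M β μ (klFlowFrameU L M β U μ m) (klScale klE0 m)) + ((t : ℂ)) • (normalCovariance L M (fun ks => uvSymbolCT L M β μ (klFlowFrameU L M β U μ (m + 1)) (klScale klE0 m) ks / (1 + uvSymbolCT L M β μ (klFlowFrameU L M β U μ (m + 1)) (klScale klE0 m) ks * (((fsub (klFlowFrameU L M β U μ (m + 1)) (klFlowFrameU L M β U μ m)).eval (latticeMomentum L ks.1.2) / (β * (L : ℝ) ^ 2) : ℝ) : ℂ))) - normalCovariance L M (uvSymbolCT L M β μ (klFlowFrameU L M β U μ m) (klScale klE0 m)))) (hubbardInteraction L M β U + counterQuadratic L M β (klFlowFrameU L M β U μ m))) 2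
            (![((0, σ), 0), ((0, σ), 1)] : Fin 2 → SectorLeg 1) x‖ ≤ cS l * U * ((4 : ℝ) ^ m) ^ l))
    (hSps : ∀ t ∈ Set.Icc (0 : ℝ) 1, ∀ (σ : Fin 2) (x₀ : SpaceTimeIdx L M),
      (imagTimeWeight β M * ∑ x ∈ (univ : Finset (Fin 2 → SpaceTimeIdx L M)).filter (fun x => x 0 = x₀),
        (1 + ((((x 1).2 - (x 0).2) 0).valMinAbs.natAbs : ℝ) + ((((x 1).2 - (x 0).2) 1).valMinAbs.natAbs : ℝ)) ^ s *
          ‖sectorisedKernel L M β (trivialMultiplier L M)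
            (effAction ℂ (normalCovariance L M (uvSymbolCT L M β μ (klFlowFrameU L M β U μ m) (klScale klE0 m)) + ((t : ℂ)) • (normalCovariance L M (fun ks => uvSymbolCT L M β μ (klFlowFrameU L M β U μ (m + 1)) (klScale klE0 m) ks / (1 + uvSymbolCT L M β μ (klFlowFrameU L M β U μ (m + 1)) (klScale klE0 m) ks * (((fsub (klFlowFrameU L M β U μ (m + 1)) (klFlowFrameU L M β U μ m)).eval (latticeMomentum L ks.1.2) / (β * (L : ℝ) ^ 2) : ℝ) : ℂ))) - normalCovariance L M (uvSymbolCT L M β μ (klFlowFrameU L M β U μ m) (klScale klE0 m)))) (hubbardInteraction L M β U + counterQuadratic L M β (klFlowFrameU L M β U μ m))) 2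
            (![((0, σ), 0), ((0, σ), 1)] : Fin 2 → SectorLeg 1) x‖ ≤ cSs * U * ((4 : ℝ) ^ m) ^ s))
    (hSEp : ∀ l ≤ 4, ∀ (σ : Fin 2) (x₀ : SpaceTimeIdx L M),
      (imagTimeWeight β M * ∑ x ∈ (univ : Finset (Fin 2 → SpaceTimeIdx L M)).filter (fun x => x 0 = x₀),
        (1 + ((((x 1).2 - (x 0).2) 0).valMinAbs.natAbs : ℝ) + ((((x 1).2 - (x 0).2) 1).valMinAbs.natAbs : ℝ)) ^ l *
          ‖sectorisedKernel L M β (trivialMultiplier L M)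
            (effAction ℂ (normalCovariance L M (fun ks => uvSymbolCT L M β μ (klFlowFrameU L M β U μ (m + 1)) (klScale klE0 m) ks / (1 + uvSymbolCT L M β μ (klFlowFrameU L M β U μ (m + 1)) (klScale klE0 m) ks * (((fsub (klFlowFrameU L M β U μ (m + 1)) (klFlowFrameU L M β U μ m)).eval (latticeMomentum L ks.1.2) / (β * (L : ℝ) ^ 2) : ℝ) : ℂ)))) (hubbardInteraction L M β U + counterQuadratic L M β (klFlowFrameU L M β U μ m))) 2
            (![((0, σ), 0), ((0, σ), 1)] : Fin 2 → SectorLeg 1) x‖ ≤ cE l * U * ((4 : ℝ) ^ m) ^ l))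
    (hSEs : ∀ (σ : Fin 2) (x₀ : SpaceTimeIdx L M),
      (imagTimeWeight β M * ∑ x ∈ (univ : Finset (Fin 2 → SpaceTimeIdx L M)).filter (fun x => x 0 = x₀),
        (1 + ((((x 1).2 - (x 0).2) 0).valMinAbs.natAbs : ℝ) + ((((x 1).2 - (x 0).2) 1).valMinAbs.natAbs : ℝ)) ^ s *
          ‖sectorisedKernel L M β (trivialMultiplier L M)
            (effAction ℂ (normalCovariance L M (fun ks => uvSymbolCT L M β μ (klFlowFrameU L M β U μ (m + 1)) (klScale klE0 m) ks / (1 + uvSymbolCT L M β μ (klFlowFrameU L M β U μ (m + 1)) (klScale klE0 m) ks * (((fsub (klFlowFrameU L M β U μ (m + 1)) (klFlowFrameU L M β U μ m)).eval (latticeMomentum L ks.1.2) / (β * (L : ℝ) ^ 2) : ℝ) : ℂ)))) (hubbardInteraction L M β U + counterQuadratic L M β (klFlowFrameU L M β U μ m))) 2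
            (![((0, σ), 0), ((0, σ), 1)] : Fin 2 → SectorLeg 1) x‖ ≤ cEs * U * ((4 : ℝ) ^ m) ^ s))
    -- the (B) budget word as a primed table
    {X : ℕ → ℝ} (hX0 : ∀ l, 0 ≤ X l)
    (hXv : 2 ^ 32 / 4 ^ 0 * R.Gfr 0 * cN 0 + (klEngRsq R ^ 4 * (cS 0 ^ 2 + cE 0 + 1) + (cSs ^ 2 + cEs + 1)) / 2 ^ 200 ≤ X 0)
    (hX : ∀ l, 1 ≤ l → l ≤ 4 → 2 ^ 32 / 4 ^ l * R.Gfr 0 * cN l + (klEngRsq R ^ 4 * (cS l ^ 2 + cE l + 1) + (cSs ^ 2 + cEs + 1)) / 2 ^ 200 ≤ X l)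
    -- the (P)-step's other inputs (k3c3-p1 `twoLegReadPriv_flow_succ` at `n := m`)
    (hLdeg : 4 * klFlowDeg (m + 1) ≤ L)
    {cA cA' eJ eJ' cc cc' : ℕ → ℝ} {τA a x₀ : ℝ}
    -- (A): slice-increment jets and structured value at the new frame
    (hA : TwoLegCurveJetBound L M cA cA' β U μ (klFlowFrameU L M β U μ (m + 1)) (m + 1))
    (hAval : ∀ θ : ℝ, |klTwoLegCurveProfile L M β U μ (klFlowFrameU L M β U μ (m + 1)) (m + 1) θ - τA| ≤
      a * U ^ 2 * (4 : ℝ) ^ (-2 * ((m + 1 : ℕ) : ℤ)))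
    -- (C2): the #17 export at `(K_m, m)`, five n-free rows, and a primed table above `transport_jets_flow_fit`'s
    {z : ℕ → ℝ} (hZsp : TwoLegDualSpaceMomentsUpToAt L M (klZspLaw z U m) β U μ m 5)
    {mT : ℕ → ℝ} (hmT : ∀ j, 0 ≤ mT j)
    (hmT1 : 4 / 3 * R.Gfr 1 + 2 * z 1 ≤ mT 1) (hmT2 : R.Gfr 2 + 2 * z 2 ≤ mT 2) (hmT3 : R.Gfr 3 / 3 + 2 * z 3 ≤ mT 3)
    (hmT4 : R.Gfr 4 / 15 + 2 * z 4 ≤ mT 4) (hmT5 : 2 ^ 5 * (Real.pi ^ 8 / 4 * 2 ^ 4 * (2 : ℝ) ^ 32) * (curveExtC (klChi2CauchyTab2 4) G.S 1 + curveExtC (klChi2CauchyTab2 4) Q.S' 1 * |U|) / 63 + 2 * z 5 ≤ mT 5)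
    {eT' : ℕ → ℝ} (heT : ∀ k ≤ 4,
        (fun k : ℕ =>
          if k = 0 then 16 * ((12.2 * R.Gfr 0 * mT 1))
          else if k = 1 then 4 * ((1420 * 2 * (R.Gfr 1 + R.Gfr 2 + R.Gfr 3 + R.Gfr 4) * 2 * mT 1) + (36400 * R.Gfr 0 * mT 1) + (2820 * R.Gfr 0 * mT 2))
          else if k = 2 then ((12900000 * 2 ^ 2 * (R.Gfr 1 + R.Gfr 2 + R.Gfr 3 + R.Gfr 4) * 2 ^ 2 * mT 1) + (657000 * 2 * (R.Gfr 1 + R.Gfr 2 + R.Gfr 3 + R.Gfr 4) * 2 * mT 2) + (338000000 * 2 * R.Gfr 0 * 2 * mT 1) + (25400000 * R.Gfr 0 * mT 2) + (652000 * R.Gfr 0 * mT 3))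
          else if k = 3 then ((199000000000 * 2 ^ 3 * (R.Gfr 1 + R.Gfr 2 + R.Gfr 3 + R.Gfr 4) * 2 ^ 3 * mT 1) + (12000000000 * 2 ^ 2 * (R.Gfr 1 + R.Gfr 2 + R.Gfr 3 + R.Gfr 4) * 2 ^ 2 * mT 2) + (228000000 * 2 * (R.Gfr 1 + R.Gfr 2 + R.Gfr 3 + R.Gfr 4) * 2 * mT 3) + (5230000000000 * 2 ^ 2 * R.Gfr 0 * 2 ^ 2 * mT 1) + (392000000000 * 2 * R.Gfr 0 * 2 * mT 2) + (11800000000 * R.Gfr 0 * mT 3) + (151000000 * R.Gfr 0 * mT 4)) / 4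
          else if k = 4 then ((4300000000000000 * 2 ^ 4 * (R.Gfr 1 + R.Gfr 2 + R.Gfr 3 + R.Gfr 4) * 2 ^ 4 * mT 1) + (276000000000000 * 2 ^ 3 * (R.Gfr 1 + R.Gfr 2 + R.Gfr 3 + R.Gfr 4) * 2 ^ 3 * mT 2) + (6890000000000 * 2 ^ 2 * (R.Gfr 1 + R.Gfr 2 + R.Gfr 3 + R.Gfr 4) * 2 ^ 2 * mT 3) + (70100000000 * 2 * (R.Gfr 1 + R.Gfr 2 + R.Gfr 3 + R.Gfr 4) * 2 * mT 4) + (114000000000000000 * 2 ^ 2 * R.Gfr 0 * 2 ^ 2 * mT 1) + (8490000000000000 * 2 ^ 2 * R.Gfr 0 * 2 ^ 2 * mT 2) + (272000000000000 * 2 * R.Gfr 0 * 2 * mT 3) + (4530000000000 * R.Gfr 0 * mT 4) + (34800000000 * R.Gfr 0 * mT 5) + (69200000000 * (16 / 15) * R.Gfr 4 * mT 1)) / 16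
          else 0) k ≤ eT' k)
    -- (C1): Jackson remainder
    (hJdiff : ContDiff ℝ 4 fun θ : ℝ => klLocalPart L M β U μ (klFlowFrameU L M β U μ m) m θ -
      (klFlowPiece L M β U μ m).eval (klFermiPoint μ (klFlowFrameU L M β U μ (m + 1)) θ))
    (hJ : ∀ k ≤ 4, ∀ θ : ℝ, |iteratedDeriv k (fun θ : ℝ => klLocalPart L M β U μ (klFlowFrameU L M β U μ m) m θ -
      (klFlowPiece L M β U μ m).eval (klFermiPoint μ (klFlowFrameU L M β U μ (m + 1)) θ)) θ| ≤ curveJetBar eJ eJ' U k (m + 1))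
    (heJ0 : eJ 0 = 0)
    -- the three private fits, (B) and (C2) un-primed columns EMPTY
    (hfit : ∀ k, cA k + eJ k ≤ cc k)
    (hfit' : ∀ k, cA' k + ((if k = 0 then X 0 else readJetC X k + readJetC' R X k) + eT' k + eJ' k) ≤ cc' k)
    (hfitO : a + (X 0 + eT' 0 + eJ' 0) ≤ x₀ / 2) :
    TwoLegReadJetBound L M cc cc' β U μ (klFlowFrameU L M β U μ (m + 1)) (m + 1) ∧
      TwoLegReadOscAt L M x₀ β U μ (klFlowFrameU L M β U μ (m + 1)) (m + 1) := by
  obtain ⟨hTdiff, hT0⟩ := transport_jets_flow_fit_of_spaceMoments_l2 (L := L) (M := M) hR hGS hQS hc hcle hU hUle hG34U hβmin hβc hμ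
    (Nat.le_of_succ_le hm1) (FrameOK.mono hR hN₁ hOK₁) (FrameOK.mono hR hNn hOK₂) (salmhoferCutoff_flat_cauchy_table2 4)
    hP hTJ hmn hLdeg hmT hZsp hmT1 hmT2 hmT3 hmT4 hmT5
  have hT : ∀ k ≤ 4, ∀ θ : ℝ, |iteratedDeriv k (fun θ : ℝ =>
      (symInterp L (klLocSelfEnergyRe L M β U μ (klFlowFrameU L M β U μ m) m)).eval (klFermiPoint μ (klFlowFrameU L M β U μ (m + 1)) θ) -
        klLocalPart L M β U μ (klFlowFrameU L M β U μ m) m θ) θ| ≤ curveJetBar (fun _ => 0) eT' U k (m + 1) :=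
    fun k hk θ => (hT0 k hk θ).trans (curveJetBar_zero_mono_snd_at (heT k hk))
  have hfit2 : ∀ k, cA k + ((fun _ : ℕ => (0 : ℝ)) k + eJ k) ≤ cc k := fun k => by simpa using hfit k
  exact twoLegReadPriv_flow_succ_of_pos_pure hR hc hcle hU hU1 hUle hβmin hβc hμ m hm1 hGS hQS hOK₁ hOK₂ (hNn.trans (Nat.le_succ m)) hZ₂ hZ hP hTJ hmn
    hR0 hW hΞ hΘ hdoor hL hs hcN hcS hcE hcSs hcEs hNp0 hNp hSp hSps hSEp hSEs hX0 hXv hX hLdeg hA hAval hTdiff hT hJdiff hJ rfl heJ0 hfit2 hfit' hfitO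

end Summit.HubbardSuperconductivity.HubbardSuperconductivity.Theorems.EngineV8

end
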